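import Summits.BirchSwinnertonDyer.Rank1Residual.GaloisImage.KolyvaginDerivativeAlgebra
import HarnessLib

/-!
# The derivative of an INTEGRAL Euler family is invariant MODULO the Kolyvagin ideal
# ([Rubin00] Lemma 4.4.2 before reduction; abstract form) — file U1 of the proposed row T-DER-BU
# (cell `b2b-bsdres`, team n1011, seat p15 GEN 27 — custodian by-product, OFFERED, not a deal)

HONEST FRAMING (cell `b2b-bsdres`, run/shared/lean/b2b/bsd-rank1-residual/, verbatim in every
file): the goal of the cell is to DELETE the COMBINATION-SHAPED residual classes of the
Birch–Swinnerton-Dyer formula for ALL analytic-rank `≤ 1` elliptic curves over `ℚ` — "full BSD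
formula for every rank `≤ 1` curve in class `C`" assembled STRICTLY from published theorems — so
that the rank-`≤ 1` remainder becomes exactly the CONSTRUCTION-SHAPED classes, which are TYPED
(missing-input `Prop`s), NOT attempted. This is not "finishing BSD". Team n1011 (N10 / N11, the
additive block X4 ∧ `p = 3`): research route on the CONSTRUCTION-SHAPED class X4; no claim beyond the
stated classes; nothing is booked. TOOL theorems of module algebra (no definition, no named fact, no
`sorry`); curve-free, `p`-free, cohomology-free.

## What

F1 (`KolyvaginDerivativeAlgebra`, n1011-p11) proves Rubin's Lemma 4.4.2 in the abstract form
"the derivative `D_r x_r` of an Euler family KILLED by `N_ℓ` and `P_ℓ(1)` is fixed by every `σ_q`" —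
the form available AFTER reduction `T → T/M`.  This file is the same induction BEFORE reduction:
for an Euler family `x_s` (`s ⊆ r`) lying in a submodule `W` of an `A`-module `X` (the intended `X`:
`H¹(U_r, T)`; the intended `W`: the classes UNRAMIFIED at the places over a fixed `w ∤ p·r`), and a
submodule `J ≤ X` receiving `N_ℓ • W` and `P_ℓ(1) • W` (the intended `J = 𝔞_r • W`,
`𝔞_r = ⟨N_ℓ, P_ℓ(1) : ℓ ∈ r⟩` — the ideal killing `T/M` for Kolyvagin primes) and stable under the
Frobenius operators `F_ℓ`:

* `sub_mem_of_eulerFamily_mod` / `sub_mem_noncommProd_deriv_of_eulerFamily_mod`: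
  **`σ_q (D_s x_s) − D_s x_s ∈ J` for all `s ⊆ r`, `q ∈ r`**, by Rubin's induction
  `(σ_q − 1) D_s x_s = N_q • z − P_q(F_q) D_{s∖q} x_{s∖q}` with
  `P_q(F_q) y − P_q(1) • y ∈ J` as soon as `(F_q − 1) y ∈ J` (`aeval_apply_sub_eval_one_smul_mem`).

WHY (design `HOME/b2b-bsdres-n1011-p15/g27/T-DER-BU-SCOPING.md`): with `W` = unramified classes,
this exhibits `(g − 1) · D_r c_r` as an `𝔞_r`-combination of UNRAMIFIED `T`-classes — the integral
witness that lets Kolyvagin's descended class at a bad place `w` be computed INSIDE `T^{I_w}`, i.e.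
`loc_w κ_r ∈ im(H¹_ur(ℚ_w, T) → H¹(ℚ_w, T/M)) ⊆ 𝓕_can,w` with NO condition on the Kolyvagin primes
([MR04] Remark A.5: "the classes `κ_n` … lie in `H¹_{(𝓕_u)_n}(ℚ, T/I_nT)`"; [Büyükboduk 2009] §3).

References: K. Rubin, *Euler Systems*, Annals of Math. Studies 147 (2000), §4.4, Lemma 4.4.2;
B. Mazur, K. Rubin, *Kolyvagin systems*, Mem. AMS 799 (2004), App. A (34)–(35) (p. 83) and Remark A.5 (p. 81);
K. Büyükboduk, *Tamagawa defect of Euler systems*, JNT 129 (2009), §3 Remark 2 / Thm. 3.1.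
-/

noncomputable section

open Finset Polynomial

universe u v w

namespace Summit.BirchSwinnertonDyer.Rank1Residual.GaloisImage

namespace Derivative

section Module

variable {A : Type u} [CommRing A] {X : Type v} [AddCommGroup X] [Module A X]

/-- If `F` preserves the submodule `J` and `F y − y ∈ J`, then `F^n y − y ∈ J` for every `n`
(`F^{n+1} y − y = F (F^n y − y) + (F y − y)`). [folklore] -/
theorem pow_apply_sub_mem (F : Module.End A X) (J : Submodule A X) (hFJ : ∀ z ∈ J, F z ∈ J)
    (y : X) (hy : F y - y ∈ J) (n : ℕ) : (F ^ n) y - y ∈ J := by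
  induction n with
  | zero => rw [pow_zero, Module.End.one_apply, sub_self]; exact J.zero_mem
  | succ n ih =>
    have e : (F ^ (n + 1)) y - y = F ((F ^ n) y - y) + (F y - y) := by
      rw [pow_succ', Module.End.mul_apply, map_sub]; abel
    rw [e]
    exact J.add_mem (hFJ _ ih) hy

/-- If `F` preserves `J` and `F y − y ∈ J` then `P(F) y − P(1) • y ∈ J` for every polynomial `P`:
the congruence form of F1's `aeval_apply_eq_eval_one_smul_of_apply_eq`. [folklore] -/
theorem aeval_apply_sub_eval_one_smul_mem (F : Module.End A X) (J : Submodule A X)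
    (hFJ : ∀ z ∈ J, F z ∈ J) (P : A[X]) (y : X) (hy : F y - y ∈ J) :
    aeval F P y - (P.eval 1) • y ∈ J := by
  rw [aeval_eq_sum_range, eval_eq_sum_range, LinearMap.sum_apply, sum_smul, ← sum_sub_distrib]
  refine J.sum_mem fun n _ => ?_
  rw [LinearMap.smul_apply, one_pow, mul_one, ← smul_sub]
  exact J.smul_mem _ (pow_apply_sub_mem F J hFJ y hy n)

variable {ι : Type w} [DecidableEq ι]

/-- **The derivative of an integral Euler family is invariant modulo `J`** (Rubin, *Euler Systems*,
Lemma 4.4.2 — the computation BEFORE reducing the coefficients).  Data as in F1's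
`apply_deriv_apply_eq_of_eulerFamily`: pairwise commuting `σ_ℓ`, Frobenius operators `F_ℓ`
commuting with the product operators `Dr s` (`Dr (insert ℓ s) = D_ℓ * Dr s`, `D_ℓ = Σ_{i<N_ℓ} i σ_ℓ^i`),
polynomials `P_ℓ`, and a family `x_s` (`s ⊆ r`) with the EXACT Euler-family relations
(`hfix`, `hord`, `hnorm`).  Instead of "`N_ℓ` and `P_ℓ(1)` kill `X`": a submodule `W ∋ x_s` stable
under the `Dr s` (`hDW`), a submodule `J` stable under the `F_ℓ` (`hFJ`) with `N_ℓ • W ⊆ J`,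
`P_ℓ(1) • W ⊆ J` (`hN`, `hP`), and (h4) in congruence form: `F_ℓ − 1` maps into `J` every `y ∈ W`
with all `σ_q y − y ∈ J` (`hF`).  Conclusion: **`σ_q (Dr s x_s) − Dr s x_s ∈ J`** for all `s ⊆ r`,
`q ∈ r`.  Proof: `(σ_q − 1) D_s x_s = N_q • z − N_{σ_q} z` (`z = D_{s∖q} x_s ∈ W`),
`N_{σ_q} z = P_q(F_q) (D_{s∖q} x_{s∖q})`, and `P_q(F_q) y − P_q(1) • y ∈ J` by induction and
`aeval_apply_sub_eval_one_smul_mem`. [cite: Rubin2000, Lemma 4.4.2] -/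
theorem sub_mem_of_eulerFamily_mod
    (σ F : ι → Module.End A X) (N : ι → ℕ) (P : ι → A[X]) (Dr : Finset ι → Module.End A X)
    (r : Finset ι) (x : Finset ι → X) (W J : Submodule A X)
    (hDins : ∀ s ℓ, ℓ ∉ s →
      Dr (insert ℓ s) = (∑ i ∈ range (N ℓ), (i : Module.End A X) * σ ℓ ^ i) * Dr s)
    (hσD : ∀ a s, Commute (σ a) (Dr s)) (hFD : ∀ a s, Commute (F a) (Dr s))
    (hDW : ∀ s, ∀ y ∈ W, Dr s y ∈ W) (hFJ : ∀ a, ∀ y ∈ J, F a y ∈ J)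
    (hxW : ∀ s ⊆ r, x s ∈ W)
    (hfix : ∀ s ⊆ r, ∀ ℓ ∈ r, ℓ ∉ s → σ ℓ (x s) = x s)
    (hord : ∀ s ⊆ r, ∀ ℓ ∈ s, (σ ℓ ^ N ℓ) (x s) = x s)
    (hnorm : ∀ s ⊆ r, ∀ ℓ ∈ s, (∑ i ∈ range (N ℓ), σ ℓ ^ i) (x s) = aeval (F ℓ) (P ℓ) (x (s.erase ℓ)))
    (hN : ∀ ℓ ∈ r, ∀ y ∈ W, (N ℓ : A) • y ∈ J) (hP : ∀ ℓ ∈ r, ∀ y ∈ W, (P ℓ).eval 1 • y ∈ J)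
    (hF : ∀ ℓ ∈ r, ∀ y ∈ W, (∀ q ∈ r, σ q y - y ∈ J) → F ℓ y - y ∈ J) :
    ∀ s ⊆ r, ∀ q ∈ r, σ q (Dr s (x s)) - Dr s (x s) ∈ J := by
  -- strong induction on the cardinality of `s`
  suffices h : ∀ n : ℕ, ∀ s ⊆ r, s.card = n → ∀ q ∈ r, σ q (Dr s (x s)) - Dr s (x s) ∈ J from
    fun s hs q hq => h s.card s hs rfl q hq
  intro n
  induction n using Nat.strong_induction_on with
  | _ n ih =>
  intro s hs hcard q hq
  by_cases hqs : q ∈ s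
  · -- the interesting case: peel `q` off `s`
    set s' := s.erase q with hs'
    have hqs' : q ∉ s' := Finset.notMem_erase q s
    have hss : s = insert q s' := (Finset.insert_erase hqs).symm
    have hs's : s' ⊆ r := (Finset.erase_subset q s).trans hs
    have hcard' : s'.card < n := by
      rw [← hcard, hs']
      exact Finset.card_erase_lt_of_mem hqs
    -- induction hypothesis: `Dr s' (x s')` is invariant modulo `J`
    have IH : ∀ a ∈ r, σ a (Dr s' (x s')) - Dr s' (x s') ∈ J :=
      fun a ha => ih s'.card hcard' s' hs's rfl a ha
    -- `z := Dr s' (x s) ∈ W` satisfies `σ_q^{N_q} z = z`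
    set z := Dr s' (x s) with hz
    have hzW : z ∈ W := hDW s' _ (hxW s hs)
    have hzN : (σ q ^ N q) z = z := by
      rw [hz]
      exact apply_apply_eq_of_commute ((hσD q s').pow_left (N q)) (hord s hs q hqs)
    -- `Dr s (x s) = D_q z`
    have hDs' : Dr s = (∑ i ∈ range (N q), (i : Module.End A X) * σ q ^ i) * Dr s' := by
      rw [hss]
      exact hDins s' q hqs'
    have hDs : Dr s (x s) = (∑ i ∈ range (N q), (i : Module.End A X) * σ q ^ i) z := by
      rw [hDs', Module.End.mul_apply]
    -- telescoping: `(σ_q - 1)(D_q z) = N_q • z - N_{σ_q} z`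
    have htel := sub_one_deriv_apply_of_pow_apply_eq (σ q) (N q) z hzN
    -- the norm term: `N_{σ_q} z = P_q(F_q) (Dr s' x_{s'})`
    have hc₁ : Commute (Dr s') (∑ i ∈ range (N q), σ q ^ i) :=
      commute_norm_of_commute (hσD q s').symm (N q)
    have hc₂ : Commute (Dr s') (aeval (F q) (P q)) :=
      commute_aeval_of_commute (hFD q s').symm (P q)
    have hnormz : (∑ i ∈ range (N q), σ q ^ i) z = aeval (F q) (P q) (Dr s' (x s')) := by
      calc (∑ i ∈ range (N q), σ q ^ i) z
          = Dr s' ((∑ i ∈ range (N q), σ q ^ i) (x s)) := (apply_comm_of_commute hc₁ (x s)).symm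
        _ = Dr s' (aeval (F q) (P q) (x s')) := by rw [hnorm s hs q hqs]
        _ = aeval (F q) (P q) (Dr s' (x s')) := apply_comm_of_commute hc₂ (x s')
    -- `y' := Dr s' (x s') ∈ W`, `(F_q - 1) y' ∈ J`, hence `P_q(F_q) y' - P_q(1) • y' ∈ J`
    have hy'W : Dr s' (x s') ∈ W := hDW s' _ (hxW s' hs's)
    have hFy : F q (Dr s' (x s')) - Dr s' (x s') ∈ J := hF q hq _ hy'W IH
    have haeval : aeval (F q) (P q) (Dr s' (x s')) - (P q).eval 1 • Dr s' (x s') ∈ J :=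
      aeval_apply_sub_eval_one_smul_mem (F q) J (hFJ q) (P q) _ hFy
    -- assemble
    have hsub : σ q (Dr s (x s)) - Dr s (x s) =
        (N q : A) • z - aeval (F q) (P q) (Dr s' (x s')) := by
      have h1 := htel
      rw [LinearMap.sub_apply, Module.End.one_apply] at h1
      rw [hDs, h1, hnormz]
    rw [hsub]
    have h2 : aeval (F q) (P q) (Dr s' (x s')) ∈ J := by
      have e : aeval (F q) (P q) (Dr s' (x s')) =
          (aeval (F q) (P q) (Dr s' (x s')) - (P q).eval 1 • Dr s' (x s')) +
            (P q).eval 1 • Dr s' (x s') := by abel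
      rw [e]
      exact J.add_mem haeval (hP q hq _ hy'W)
    exact J.sub_mem (hN q hq z hzW) h2
  · -- `q ∉ s`: `σ_q` commutes with `Dr s` and fixes `x s`
    have hfx : σ q (Dr s (x s)) = Dr s (x s) :=
      apply_apply_eq_of_commute (hσD q s) (hfix s hs q hq hqs)
    rw [hfx, sub_self]
    exact J.zero_mem

omit [DecidableEq ι] in
/-- A derivative operator `Σ_{i<N} i σ^i` preserves every submodule preserved by `σ` (the `Submodule`
twin of F7's `Derivative.deriv_apply_mem` for `AddSubgroup`s). [folklore] -/
theorem deriv_apply_mem_submodule (σ : Module.End A X) (N : ℕ) (W : Submodule A X)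
    (hσW : ∀ y ∈ W, σ y ∈ W) (y : X) (hy : y ∈ W) :
    (∑ i ∈ range N, (i : Module.End A X) * σ ^ i) y ∈ W := by
  have hpowW : ∀ (n : ℕ), ∀ y ∈ W, (σ ^ n) y ∈ W := fun n => by
    induction n with
    | zero => intro y hy; rwa [pow_zero, Module.End.one_apply]
    | succ n ih => intro y hy; rw [pow_succ, Module.End.mul_apply]; exact ih _ (hσW y hy)
  rw [LinearMap.sum_apply]
  refine W.sum_mem fun i _ => ?_
  rw [Module.End.mul_apply, Module.End.natCast_apply]
  exact W.nsmul_mem (hpowW i y hy) i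

/-- **Invariance modulo `J` for `D_r = r.noncommProd D_•`** (the form consumed by the
cohomological instantiation): under the hypotheses of `sub_mem_of_eulerFamily_mod`, with
`Dr s := s.noncommProd (ℓ ↦ Σ_{i<N_ℓ} i σ_ℓ^i)` and `W` stable under the `σ_ℓ` (so that every `Dr s`
preserves `W`), `σ_q (D_s x_s) − D_s x_s ∈ J` for all `s ⊆ r`, `q ∈ r`.
Ref: Rubin, *Euler Systems* (2000), Def. 4.4.1, Lemma 4.4.2. [cite: Rubin2000, Lemma 4.4.2] -/
theorem sub_mem_noncommProd_deriv_of_eulerFamily_mod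
    (σ F : ι → Module.End A X) (N : ι → ℕ) (P : ι → A[X]) (r : Finset ι) (x : Finset ι → X)
    (W J : Submodule A X)
    (hσσ : ∀ a b, Commute (σ a) (σ b)) (hFσ : ∀ a b, Commute (F a) (σ b))
    (hσW : ∀ a, ∀ y ∈ W, σ a y ∈ W) (hFJ : ∀ a, ∀ y ∈ J, F a y ∈ J)
    (hxW : ∀ s ⊆ r, x s ∈ W)
    (hfix : ∀ s ⊆ r, ∀ ℓ ∈ r, ℓ ∉ s → σ ℓ (x s) = x s)
    (hord : ∀ s ⊆ r, ∀ ℓ ∈ s, (σ ℓ ^ N ℓ) (x s) = x s)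
    (hnorm : ∀ s ⊆ r, ∀ ℓ ∈ s, (∑ i ∈ range (N ℓ), σ ℓ ^ i) (x s) = aeval (F ℓ) (P ℓ) (x (s.erase ℓ)))
    (hN : ∀ ℓ ∈ r, ∀ y ∈ W, (N ℓ : A) • y ∈ J) (hP : ∀ ℓ ∈ r, ∀ y ∈ W, (P ℓ).eval 1 • y ∈ J)
    (hF : ∀ ℓ ∈ r, ∀ y ∈ W, (∀ q ∈ r, σ q y - y ∈ J) → F ℓ y - y ∈ J)
    (s : Finset ι) (hs : s ⊆ r) (q : ι) (hq : q ∈ r) :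
    σ q ((s.noncommProd (fun ℓ => ∑ i ∈ range (N ℓ), (i : Module.End A X) * σ ℓ ^ i)
        fun a _ b _ _ => commute_deriv_deriv hσσ N a b) (x s)) -
      (s.noncommProd (fun ℓ => ∑ i ∈ range (N ℓ), (i : Module.End A X) * σ ℓ ^ i)
        fun a _ b _ _ => commute_deriv_deriv hσσ N a b) (x s) ∈ J := by
  refine sub_mem_of_eulerFamily_mod σ F N P
    (fun s => s.noncommProd (fun ℓ => ∑ i ∈ range (N ℓ), (i : Module.End A X) * σ ℓ ^ i)
      fun a _ b _ _ => commute_deriv_deriv hσσ N a b)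
    r x W J (fun s ℓ hℓ => ?_) (fun a s => ?_) (fun a s => ?_) (fun s y hy => ?_) hFJ hxW
    hfix hord hnorm hN hP hF s hs q hq
  · exact Finset.noncommProd_insert_of_notMem s ℓ _ _ hℓ
  · exact Finset.noncommProd_commute _ _ _ _ fun b _ => commute_deriv_of_commute (hσσ a b) (N b)
  · exact Finset.noncommProd_commute _ _ _ _ fun b _ => commute_deriv_of_commute (hFσ a b) (N b)
  · -- every `Dr s` preserves `W`
    refine Finset.noncommProd_induction s _ _ (fun T : Module.End A X => ∀ y ∈ W, T y ∈ W)
      (fun T₁ T₂ h₁ h₂ y hy => ?_) (fun y hy => ?_) (fun ℓ _ y hy => ?_) y hy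
    · rw [Module.End.mul_apply]; exact h₁ _ (h₂ y hy)
    · rwa [Module.End.one_apply]
    · exact deriv_apply_mem_submodule (σ ℓ) (N ℓ) W (hσW ℓ) y hy

end Module

end Derivative

end Summit.BirchSwinnertonDyer.Rank1Residual.GaloisImage

end
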